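import Summits.KontsevichZagierPeriods.KontsevichZagierPeriods.Theorems.RootDecompRelativeModAbsoluteRegFoldingDegOneP04

/-!
# `RegFoldingDegOne` (route `RootDecompRelativeModAbsolute`, support item stmt-KontsevichZagierPeriods-30571) — PROVED · part 5/14

Cell `decomp-kz`, lens 3 (decomp-kz-lens-3 g9): `regFoldingDegOne_holds :
Theses.RootDecompRelativeModAbsolute.RegFoldingDegOne` BY NAME (in part 14/14) — every Kontsevich–Zagier
integral representation on `ℝ²` whose integrand is a quotient `p/q` of `ℚ`-polynomials with `deg_t q ≤ 1`,
`q ≠ 0` on the domain, is equivalent in `KZ.relations` to `[g] + Σᵢ [Uᵢ]`, the `Uᵢ` honest 2-cells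
`[g.domain × (0,1), hᵢ(x) θ^{Mᵢ}/(1 + θ^{eᵢ} κᵢ(x))]` (unfolded REGULARISED log/arctan monomials), with the
fibre integrals matching a.e.  Architecture: §1–§2 regularised terms `RTerm`, `RegFolding d`; §7 a.e.-congruence;
§8 gluing (`FoldsTo`); §9 one-band toolkit; §P analytic core (kernel independence); §10 cylinders; §11 affine band
chart; §13 `RegFolding 1` from a CAD band cover a.e. + vanishing on unbounded bands; last part: the edge to the born
item text and `regFoldingDegOne_holds`.

Source: `HOME/decomp-kz-lens-3/g9/landing/RootDecompRelativeModAbsoluteRegFoldingDegOne.lean` sha256 60038aa44a5f6303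
(4275 l; critic decomp-kz-crit-1 g2 CLEARED/kernel-confirmed 2026-08-30T09:41:19Z, std axioms), split mechanically
into 14 modules ≤ 400 lines by the landing seat decomp-kz-census-1 g7 (contexts re-opened per part; generic docstrings
added where the source had none; parts 1–13 do not import the route file).  No `sorry`; standard axioms.
References: [cite: KontsevichZagier2001, §1.2]; Basu–Pollack–Roy 2006 Def. 5.1 / Cor. 5.7; Bochnak–Coste–Roy 1998 §2.9.
-/

noncomputable section

open Set MeasureTheory Filter Topology
open scoped BigOperators
open Literature.NumberTheory.Transcendental Literature.ModelTheory.ExponentialFields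

namespace Summit.KontsevichZagierPeriods.RootDecompRelativeModAbsolute.Rung30571

namespace RegularisedLogLayer

section Folds

variable {b : ℕ}

/-- **Monomial recognition.** A representation on the cylinder `σ × (0,1)` whose integrand IS a
regularised monomial `h(x) θ^M/(1 + θ^e κ(x))` (`h, κ` `ℚ`-semialgebraic on `σ`, `κ > −1`,
`e ∈ {1,2}`) folds to the single-monomial term; the integrability of `h ℓ_{M,e}(κ)` on `σ` is
DERIVED (Fubini). -/
theorem foldsTo_cyl_monomial (r : KZ.IntegralRep (b + 1)) {σ : Set (Fin b → ℝ)}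
    (hσ : IsSemialgebraic ℚ σ) {h κ : (Fin b → ℝ) → ℝ} (hh : IsSemialgebraicFunOn ℚ σ h)
    (hκ : IsSemialgebraicFunOn ℚ σ κ) {M e : ℕ} (he : e = 1 ∨ e = 2) (hκ1 : ∀ x ∈ σ, -1 < κ x)
    (hdom : r.domain = RTerm.cyl σ)
    (hint : EqOn r.integrand
      (fun z => h (Fin.init z) * kernel M e (κ (Fin.init z)) (z (Fin.last b))) r.domain) :
    ∃ hT : (RTerm.single σ h κ M e).Admissible, FoldsTo r (RTerm.single σ h κ M e) hT := by
  have hσm : MeasurableSet σ := hσ.measurableSet_holds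
  have hG : Integrable (r.domain.indicator r.integrand) :=
    (integrable_indicator_iff (KZ.IntegralRep.measurableSet_domain_holds r)).2 r.integrableOn
  -- (i) the fibre identity a.e.
  have hfibre : ∀ᵐ x : (Fin b → ℝ), (∫ t in {t : ℝ | (Fin.snoc x t : Fin (b + 1) → ℝ) ∈ r.domain},
      r.integrand (Fin.snoc x t)) = σ.indicator (fun x => h x * ell M e (κ x)) x := by
    refine ae_of_all _ fun x => ?_
    by_cases hxσ : x ∈ σ
    · rw [hdom, RTerm.fibre_cyl_of_mem hxσ, indicator_of_mem hxσ, ell, ← integral_const_mul]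
      refine setIntegral_congr_fun measurableSet_Ioo fun t ht => ?_
      have hmem : (Fin.snoc x t : Fin (b + 1) → ℝ) ∈ r.domain := by
        rw [hdom]
        exact ⟨by simpa using hxσ, by simpa using ht⟩
      rw [hint hmem]
      simp
    · rw [hdom, RTerm.fibre_cyl_of_not_mem hxσ, indicator_of_notMem hxσ, Measure.restrict_empty,
        integral_zero_measure]
  -- (ii) integrability of `h ℓ(κ)` on `σ`
  have hbase : IntegrableOn (fun x => h x * ell M e (κ x)) σ := by
    rw [← integrable_indicator_iff hσm]
    exact (integrable_fibre_integral r).congr hfibre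
  have hmono_sa : IsSemialgebraicFunOn ℚ (RTerm.cyl σ)
      (fun z => h (Fin.init z) * kernel M e (κ (Fin.init z)) (z (Fin.last b))) :=
    (hdom ▸ r.isSemialgebraicFunOn_integrand).congr (hdom ▸ hint)
  have hmono_int : IntegrableOn
      (fun z => h (Fin.init z) * kernel M e (κ (Fin.init z)) (z (Fin.last b))) (RTerm.cyl σ) :=
    (hdom ▸ r.integrableOn).congr_fun (hdom ▸ hint) (hdom ▸ KZ.IntegralRep.measurableSet_domain_holds r)
  have hT : (RTerm.single σ h κ M e).Admissible :=
    { isSemialgebraic_domain := hσ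
      isSemialgebraicFunOn_h₀ := (isSemialgebraicFunOn_ratCast hσ 0).congr fun x _ => by
        simp [RTerm.single]
      integrableOn_h₀ := by
        show IntegrableOn (0 : (Fin b → ℝ) → ℝ) σ
        exact integrableOn_zero
      isSemialgebraicFunOn_h := fun _ => hh
      isSemialgebraicFunOn_κ := fun _ => hκ
      e_mem := fun _ => he
      neg_one_lt_κ := fun _ => hκ1
      isSemialgebraicFunOn_monomial := fun i => by
        rw [RTerm.monomialFun_single]; exact hmono_sa
      integrableOn_monomial := fun i => by
        rw [RTerm.monomialFun_single]; exact hmono_int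
      integrableOn_monomial_base := fun _ => hbase }
  refine ⟨hT, ?_, ?_⟩
  · -- the relation: `[r] = [monomial]` by congruence, `[σ, 0]` is a relation
    have h0 : KZ.of (RTerm.baseRep (RTerm.single σ h κ M e) hT) ∈ KZ.relations :=
      RTerm.of_zero_mem_relations _ rfl
    have h1 : KZ.of r - KZ.of (RTerm.monomialRep (RTerm.single σ h κ M e) hT ⟨0, Nat.one_pos⟩) ∈
        KZ.relations := by
      refine AECongr.of_sub_of_mem_relations_of_indicator_ae _ _ (ae_of_all _ fun z => ?_)
      rw [RTerm.monomialRep_domain, RTerm.monomialRep_integrand, RTerm.single_domain,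
        RTerm.monomialFun_single, ← hdom]
      by_cases hz : z ∈ r.domain
      · rw [indicator_of_mem hz, indicator_of_mem hz, hint hz]
      · rw [indicator_of_notMem hz, indicator_of_notMem hz]
    have e1 : KZ.of r - RTerm.unfold (RTerm.single σ h κ M e) hT =
        (KZ.of r - KZ.of (RTerm.monomialRep (RTerm.single σ h κ M e) hT ⟨0, Nat.one_pos⟩)) -
          KZ.of (RTerm.baseRep (RTerm.single σ h κ M e) hT) := by
      rw [RTerm.unfold, show (∑ i, KZ.of (RTerm.monomialRep (RTerm.single σ h κ M e) hT i)) =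
        KZ.of (RTerm.monomialRep (RTerm.single σ h κ M e) hT ⟨0, Nat.one_pos⟩) from
          Fin.sum_univ_one _]
      abel
    rw [e1]
    exact sub_mem h1 h0
  · filter_upwards [hfibre] with x hx
    rw [hx, RTerm.single_domain, RTerm.integrand_single]

/-- The zero-extension of `r` to a larger `ℚ`-semialgebraic domain `S ⊇ r.domain` (integrand
`1_{r.domain} · r.integrand`): a representation with the same class. -/
def closedExt (r : KZ.IntegralRep (b + 1)) (S : Set (Fin (b + 1) → ℝ)) (hS : IsSemialgebraic ℚ S) :
    KZ.IntegralRep (b + 1) :=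
  ⟨S, r.domain.indicator r.integrand, hS,
    isSemialgebraicFunOn_indicator r.isSemialgebraic_domain hS r.isSemialgebraicFunOn_integrand,
    ((integrable_indicator_iff (KZ.IntegralRep.measurableSet_domain_holds r)).2
      r.integrableOn).integrableOn⟩

/-- `of_sub_of_closedExt_mem`: auxiliary theorem of the `RegFoldingDegOne` (stmt-30571) development — see the module docstring; statement and proof verbatim from the lens-3 g9 landing file. -/
theorem of_sub_of_closedExt_mem (r : KZ.IntegralRep (b + 1)) {S : Set (Fin (b + 1) → ℝ)}
    (hS : IsSemialgebraic ℚ S) (hsub : r.domain ⊆ S) :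
    KZ.of r - KZ.of (closedExt r S hS) ∈ KZ.relations := by
  refine AECongr.of_sub_of_mem_relations_of_indicator_ae r _ (ae_of_all _ fun z => ?_)
  show r.domain.indicator r.integrand z = S.indicator (r.domain.indicator r.integrand) z
  rw [Set.indicator_indicator, inter_eq_right.2 hsub]

/-- **The affine chart of a band.** Over an OPEN `ℚ`-semialgebraic `G` with DIFFERENTIABLE
`ℚ`-semialgebraic edges `α < β` (reached from any cell by `exists_isOpen_contDiffOn` and
`FoldsTo.of_restrict`), the representation `r` on the open band and its pull-back `r'` to the
cylinder `G × (0,1)` along `t = α + (β − α) θ` (integrand `(β − α) · f(x, α + (β − α) θ)`) have the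
same class (one change-of-variables move between the closed versions, which are zero-extensions)
and the same fibre integrals; so `r` folds to whatever `r'` folds to.
[KZ 2001, §1.2 rule (2); folklore] -/
theorem FoldsTo.of_affine {r r' : KZ.IntegralRep (b + 1)} {G : Set (Fin b → ℝ)} (hGo : IsOpen G)
    (hG : IsSemialgebraic ℚ G) {α β : (Fin b → ℝ) → ℝ} (hα : IsSemialgebraicFunOn ℚ G α)
    (hβ : IsSemialgebraicFunOn ℚ G β) (hαd : DifferentiableOn ℝ α G) (hβd : DifferentiableOn ℝ β G)
    (hlt : ∀ x ∈ G, α x < β x)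
    (hdom : r.domain = {z : Fin (b + 1) → ℝ | (Fin.init z : Fin b → ℝ) ∈ G ∧
      α (Fin.init z) < z (Fin.last b) ∧ z (Fin.last b) < β (Fin.init z)})
    (hdom' : r'.domain = RTerm.cyl G)
    (hint' : EqOn r'.integrand (fun w => (β (Fin.init w) - α (Fin.init w)) *
      r.integrand (Fin.snoc (Fin.init w)
        (α (Fin.init w) + (β (Fin.init w) - α (Fin.init w)) * w (Fin.last b)))) r'.domain)
    {T : RTerm b} {hT : T.Admissible} (h : FoldsTo r' T hT) : FoldsTo r T hT := by
  have hβα : IsSemialgebraicFunOn ℚ G (fun x => β x - α x) := IsSemialgebraicFunOn.sub_holds hβ hα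
  have h0 : IsSemialgebraicFunOn ℚ G (fun _ => (0 : ℝ)) :=
    (isSemialgebraicFunOn_ratCast hG 0).congr fun x _ => by simp
  have h1c : IsSemialgebraicFunOn ℚ G (fun _ => (1 : ℝ)) :=
    (isSemialgebraicFunOn_ratCast hG 1).congr fun x _ => by simp
  have hB : IsSemialgebraic ℚ (KZlog.band G α β) := KZlog.isSemialgebraic_band hα hβ
  have hC : IsSemialgebraic ℚ (KZlog.band G (fun _ => (0 : ℝ)) fun _ => (1 : ℝ)) :=
    KZlog.isSemialgebraic_band h0 h1c
  have hsubB : r.domain ⊆ KZlog.band G α β := by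
    intro z hz
    rw [hdom] at hz
    exact ⟨hz.1, hz.2.1.le, hz.2.2.le⟩
  have hsubC : r'.domain ⊆ KZlog.band G (fun _ => (0 : ℝ)) fun _ => (1 : ℝ) := by
    intro w hw
    rw [hdom'] at hw
    exact ⟨hw.1, hw.2.1.le, hw.2.2.le⟩
  -- fibre membership
  have hmem_r : ∀ x ∈ G, ∀ t, (Fin.snoc x t : Fin (b + 1) → ℝ) ∈ r.domain ↔ α x < t ∧ t < β x := by
    intro x hx t
    rw [hdom]
    simp [hx]
  have hmem_r' : ∀ x ∈ G, ∀ θ, (Fin.snoc x θ : Fin (b + 1) → ℝ) ∈ r'.domain ↔ 0 < θ ∧ θ < 1 := by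
    intro x hx θ
    rw [hdom']
    simp [RTerm.cyl, hx]
  refine FoldsTo.of_rel_of_fibre_ae ?_ ?_ h
  · -- the relation, through the closed zero-extensions and one change of variables
    have e1 := of_sub_of_closedExt_mem r hB hsubB
    have e2 := of_sub_of_closedExt_mem r' hC hsubC
    have e3 : KZ.of (closedExt r' _ hC) - KZ.of (closedExt r _ hB) ∈ KZ.relations := by
      refine KZ.of_sub_of_mem_relations_of_affine (a := fun _ => (0 : ℝ)) (b := fun _ => (1 : ℝ))
        (a' := α) (b' := β) hGo hα hβα hαd (hβd.sub hαd)
        (fun x hx => sub_pos.2 (hlt x hx)) (closedExt r' _ hC) (closedExt r _ hB) rfl rfl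
        (fun x _ => by simp) (fun x _ => by simp) fun w hw => ?_
      have hy : (Fin.init w : Fin b → ℝ) ∈ G := hw.1
      show r'.domain.indicator r'.integrand w =
        r.domain.indicator r.integrand (Fin.snoc (Fin.init w)
          (α (Fin.init w) + (β (Fin.init w) - α (Fin.init w)) * w (Fin.last b))) *
          (β (Fin.init w) - α (Fin.init w))
      have hc : 0 < β (Fin.init w) - α (Fin.init w) := sub_pos.2 (hlt _ hy)
      by_cases hwo : w ∈ r'.domain
      · have hθ : 0 < w (Fin.last b) ∧ w (Fin.last b) < 1 := by
          have := (hmem_r' _ hy (w (Fin.last b))).1 (by rw [Fin.snoc_init_self]; exact hwo)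
          exact this
        have hin : (Fin.snoc (Fin.init w) (α (Fin.init w) +
            (β (Fin.init w) - α (Fin.init w)) * w (Fin.last b)) : Fin (b + 1) → ℝ) ∈ r.domain := by
          rw [hmem_r _ hy]
          constructor <;> nlinarith [hθ.1, hθ.2]
        rw [indicator_of_mem hwo, indicator_of_mem hin, hint' hwo, mul_comm]
      · have hθ : ¬ (0 < w (Fin.last b) ∧ w (Fin.last b) < 1) := by
          intro hθ
          exact hwo (by rw [← Fin.snoc_init_self w]; exact (hmem_r' _ hy _).2 hθ)
        have hout : (Fin.snoc (Fin.init w) (α (Fin.init w) +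
            (β (Fin.init w) - α (Fin.init w)) * w (Fin.last b)) : Fin (b + 1) → ℝ) ∉ r.domain := by
          rw [hmem_r _ hy]
          intro hin
          apply hθ
          constructor <;> nlinarith [hin.1, hin.2]
        rw [indicator_of_notMem hwo, indicator_of_notMem hout, zero_mul]
    have e : KZ.of r - KZ.of r' = (KZ.of r - KZ.of (closedExt r _ hB)) -
        (KZ.of (closedExt r' _ hC) - KZ.of (closedExt r _ hB)) -
        (KZ.of r' - KZ.of (closedExt r' _ hC)) := by abel
    rw [e]
    exact sub_mem (sub_mem e1 e3) e2
  · -- the fibre integrals agree (1-d affine substitution), for every `x`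
    refine ae_of_all _ fun x => ?_
    by_cases hx : x ∈ G
    · have hfr : {t : ℝ | (Fin.snoc x t : Fin (b + 1) → ℝ) ∈ r.domain} = Ioo (α x) (β x) := by
        ext t; rw [mem_setOf_eq, hmem_r x hx]; rfl
      have hfr' : {θ : ℝ | (Fin.snoc x θ : Fin (b + 1) → ℝ) ∈ r'.domain} = Ioo 0 1 := by
        ext θ; rw [mem_setOf_eq, hmem_r' x hx]; rfl
      have hc : β x - α x ≠ 0 := (sub_pos.2 (hlt x hx)).ne'
      rw [hfr, hfr']
      have hcongr : ∫ θ in Ioo (0 : ℝ) 1, r'.integrand (Fin.snoc x θ) =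
          ∫ θ in Ioo (0 : ℝ) 1, (β x - α x) *
            r.integrand (Fin.snoc x ((β x - α x) * θ + α x)) := by
        refine setIntegral_congr_fun measurableSet_Ioo fun θ hθ => ?_
        rw [hint' ((hmem_r' x hx θ).2 hθ)]
        simp [mul_comm (β x - α x) θ, add_comm]
      have eL : ∫ t in Ioo (α x) (β x), r.integrand (Fin.snoc x t) =
          ∫ t in (α x)..(β x), r.integrand (Fin.snoc x t) := by
        rw [intervalIntegral.integral_of_le (hlt x hx).le, integral_Ioc_eq_integral_Ioo]
      have eR : ∫ θ in Ioo (0 : ℝ) 1, (β x - α x) * r.integrand (Fin.snoc x ((β x - α x) * θ + α x)) =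
          ∫ θ in (0 : ℝ)..1, (β x - α x) * r.integrand (Fin.snoc x ((β x - α x) * θ + α x)) := by
        rw [intervalIntegral.integral_of_le zero_le_one, integral_Ioc_eq_integral_Ioo]
      rw [hcongr, eL, eR, intervalIntegral.integral_const_mul,
        intervalIntegral.integral_comp_mul_add (fun t => r.integrand (Fin.snoc x t)) hc,
        mul_zero, zero_add, mul_one, sub_add_cancel, smul_eq_mul, mul_inv_cancel_left₀ hc]
    · have hfr : {t : ℝ | (Fin.snoc x t : Fin (b + 1) → ℝ) ∈ r.domain} = ∅ := by
        ext t; simp [hdom, hx]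
      have hfr' : {θ : ℝ | (Fin.snoc x θ : Fin (b + 1) → ℝ) ∈ r'.domain} = ∅ := by
        ext θ; simp [hdom', RTerm.cyl, hx]
      rw [hfr, hfr', Measure.restrict_empty, integral_zero_measure, integral_zero_measure]

/-- A representation whose integrand vanishes on its domain folds to the empty term. -/
theorem foldsTo_empty_of_integrand_zero {r : KZ.IntegralRep (b + 1)}
    (h0 : EqOn r.integrand 0 r.domain) : FoldsTo r (RTerm.empty b) (RTerm.empty_admissible b) := by
  have hind : ∀ z, r.domain.indicator r.integrand z = 0 := fun z => by
    by_cases hz : z ∈ r.domain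
    · rw [indicator_of_mem hz, h0 hz]; rfl
    · rw [indicator_of_notMem hz]
  refine ⟨?_, ?_⟩
  · have hu : RTerm.unfold (RTerm.empty b) (RTerm.empty_admissible b) =
        KZ.of (RTerm.baseRep (RTerm.empty b) (RTerm.empty_admissible b)) := by
      simp [RTerm.unfold, RTerm.empty]
    let r₀ : KZ.IntegralRep (b + 1) := ⟨r.domain, 0, r.isSemialgebraic_domain,
      (isSemialgebraicFunOn_ratCast r.isSemialgebraic_domain 0).congr fun z _ => by simp,
      integrableOn_zero⟩
    have h1 : KZ.of r - KZ.of r₀ ∈ KZ.relations := by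
      refine AECongr.of_sub_of_mem_relations_of_indicator_ae _ _ (ae_of_all _ fun z => ?_)
      rw [hind z]
      show (0 : ℝ) = r.domain.indicator (0 : (Fin (b + 1) → ℝ) → ℝ) z
      rw [Set.indicator_zero']; rfl
    have h2 : KZ.of r₀ ∈ KZ.relations := RTerm.of_zero_mem_relations r₀ rfl
    have h3 : KZ.of (RTerm.baseRep (RTerm.empty b) (RTerm.empty_admissible b)) ∈ KZ.relations :=
      RTerm.of_zero_mem_relations _ rfl
    rw [hu, show KZ.of r - KZ.of (RTerm.baseRep (RTerm.empty b) (RTerm.empty_admissible b)) =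
      (KZ.of r - KZ.of r₀) + KZ.of r₀ -
        KZ.of (RTerm.baseRep (RTerm.empty b) (RTerm.empty_admissible b)) by abel]
    exact sub_mem (add_mem h1 h2) h3
  · refine ae_of_all _ fun x => ?_
    rw [← integral_indicator_snoc r]
    simp [hind, RTerm.empty]

/-- Finite sums of `ℚ`-semialgebraic functions are `ℚ`-semialgebraic. [BCR 1998, Prop. 2.2.6] -/
private theorem isSemialgebraicFunOn_finset_sum {n : ℕ} {s : Set (Fin n → ℝ)} (hs : IsSemialgebraic ℚ s)
    {ι : Type*} (I : Finset ι) {f : ι → (Fin n → ℝ) → ℝ}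
    (hf : ∀ i ∈ I, IsSemialgebraicFunOn ℚ s (f i)) :
    IsSemialgebraicFunOn ℚ s (fun x => ∑ i ∈ I, f i x) := by
  classical
  induction I using Finset.induction_on with
  | empty => exact (isSemialgebraicFunOn_ratCast hs 0).congr fun x _ => by simp
  | insert a I ha ih =>
    have h1 : IsSemialgebraicFunOn ℚ s (f a) := hf a (Finset.mem_insert_self a I)
    have h2 := ih fun i hi => hf i (Finset.mem_insert_of_mem hi)
    refine (IsSemialgebraicFunOn.add_holds h1 h2).congr fun x _ => ?_
    simp only [Pi.add_apply, Finset.sum_insert ha]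

/-- Natural powers of a `ℚ`-semialgebraic function are `ℚ`-semialgebraic. [BCR 1998, Prop. 2.2.6] -/
theorem isSemialgebraicFunOn_pow {n : ℕ} {s : Set (Fin n → ℝ)} (hs : IsSemialgebraic ℚ s)
    {f : (Fin n → ℝ) → ℝ} (hf : IsSemialgebraicFunOn ℚ s f) (k : ℕ) :
    IsSemialgebraicFunOn ℚ s (fun x => f x ^ k) := by
  induction k with
  | zero =>
    exact (isSemialgebraicFunOn_ratCast hs 1).congr fun x _ => by simp
  | succ k ih =>
    refine (IsSemialgebraicFunOn.mul_holds ih hf).congr fun x _ => ?_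
    simp only [Pi.mul_apply, pow_succ]

/-- **Polynomial-in-θ integrands on a cylinder fold to the base** (`∫₀¹ Σ aₖ θ^k dθ = Σ aₖ/(k+1)`):
the instance `α = 0, β = 1, F = Σ aₖ θ^{k+1}/(k+1)` of `foldsTo_band_of_primitive`. -/
theorem foldsTo_cyl_polynomial (r : KZ.IntegralRep (b + 1)) {G : Set (Fin b → ℝ)}
    (hG : IsSemialgebraic ℚ G) {m : ℕ} {a : Fin (m + 1) → (Fin b → ℝ) → ℝ}
    (ha : ∀ k, IsSemialgebraicFunOn ℚ G (a k)) (hdom : r.domain = RTerm.cyl G)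
    (hint : EqOn r.integrand
      (fun z => ∑ k : Fin (m + 1), a k (Fin.init z) * z (Fin.last b) ^ (k : ℕ)) r.domain) :
    ∃ hT : (RTerm.base G (fun x => ∑ k : Fin (m + 1), a k x / ((k : ℕ) + 1))).Admissible,
      FoldsTo r (RTerm.base G (fun x => ∑ k : Fin (m + 1), a k x / ((k : ℕ) + 1))) hT := by
  have h0 : IsSemialgebraicFunOn ℚ G (fun _ => (0 : ℝ)) :=
    (isSemialgebraicFunOn_ratCast hG 0).congr fun x _ => by simp
  have h1 : IsSemialgebraicFunOn ℚ G (fun _ => (1 : ℝ)) :=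
    (isSemialgebraicFunOn_ratCast hG 1).congr fun x _ => by simp
  have hB : IsSemialgebraic ℚ (KZlog.band G (fun _ => (0 : ℝ)) fun _ => (1 : ℝ)) :=
    KZlog.isSemialgebraic_band h0 h1
  have hBG : KZlog.band G (fun _ => (0 : ℝ)) (fun _ => (1 : ℝ)) ⊆ {z | Fin.init z ∈ G} :=
    fun z hz => hz.1
  -- the primitive
  set F : (Fin (b + 1) → ℝ) → ℝ := fun z =>
    ∑ k : Fin (m + 1), a k (Fin.init z) * z (Fin.last b) ^ ((k : ℕ) + 1) / ((k : ℕ) + 1) with hF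
  have hFsa : IsSemialgebraicFunOn ℚ (KZlog.band G (fun _ => (0 : ℝ)) fun _ => (1 : ℝ)) F := by
    refine isSemialgebraicFunOn_finset_sum hB _ fun k _ => ?_
    have h1 : IsSemialgebraicFunOn ℚ _ (fun z => a k (Fin.init z)) := (ha k).comp_init_mono hB hBG
    have h2 := isSemialgebraicFunOn_pow hB (isSemialgebraicFunOn_apply hB (Fin.last b)) ((k : ℕ) + 1)
    have h3 := isSemialgebraicFunOn_ratCast hB ((1 : ℚ) / ((k : ℕ) + 1))
    exact (IsSemialgebraicFunOn.mul_holds (IsSemialgebraicFunOn.mul_holds h1 h2) h3).congr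
      fun z _ => by simp [div_eq_mul_inv]
  have hdom' : r.domain = {z : Fin (b + 1) → ℝ | (Fin.init z : Fin b → ℝ) ∈ G ∧
      (fun _ => (0 : ℝ)) (Fin.init z) < z (Fin.last b) ∧ z (Fin.last b) < (fun _ => (1 : ℝ)) (Fin.init z)} := by
    rw [hdom]; ext z; simp [RTerm.cyl]
  have hh₀ : IsSemialgebraicFunOn ℚ G (fun x => ∑ k : Fin (m + 1), a k x / ((k : ℕ) + 1)) := by
    refine isSemialgebraicFunOn_finset_sum hG _ fun k _ => ?_
    exact (IsSemialgebraicFunOn.mul_holds (ha k) (isSemialgebraicFunOn_ratCast hG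
      ((1 : ℚ) / ((k : ℕ) + 1)))).congr fun x _ => by simp [div_eq_mul_inv]
  refine foldsTo_band_of_primitive r hG h0 h1 (fun _ _ => zero_le_one) hdom' hFsa ?_ ?_ hh₀ ?_
  · intro x _
    simp only [hF, Fin.init_snoc, Fin.snoc_last]
    fun_prop
  · intro x hx t ht
    have hmem : (Fin.snoc x t : Fin (b + 1) → ℝ) ∈ r.domain := by
      rw [hdom]; exact ⟨by simpa using hx, by simpa using ht⟩
    rw [hint hmem]
    simp only [hF, Fin.init_snoc, Fin.snoc_last]
    refine HasDerivAt.fun_sum fun k _ => ?_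
    have hk : ((k : ℕ) + 1 : ℝ) ≠ 0 := by positivity
    have h := ((hasDerivAt_pow ((k : ℕ) + 1) t).const_mul (a k x)).div_const ((k : ℕ) + 1 : ℝ)
    refine h.congr_deriv ?_
    field_simp
    push_cast
    ring
  · intro x _
    simp [hF]

end Folds

end RegularisedLogLayer

end Summit.KontsevichZagierPeriods.RootDecompRelativeModAbsolute.Rung30571

end
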